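/-
Copyright (c) 2026. All rights reserved.
Released under Apache 2.0 license as described in the file LICENSE.
Authors: HodgeCM publication cell (pub-hodgecm), kernel seat `pv07`.
-/
import Mathlib.Analysis.LocallyConvex.Barrelled
import Literature.Analysis.FunctionSpaces.SchwartzComplete
import Literature.NumberTheory.Automorphic.AdelicSchwartzBruhatLF
import Literature.NumberTheory.Automorphic.AdelicTensorStripping
import Literature.NumberTheory.Weil1964.ThetaInitialTopology
import Literature.NumberTheory.Weil1964.AdelicThetaMajorants
import Literature.NumberTheory.Weil1964.AdelicThetaArchDerivative
import HarnessLib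

/-!
# Continuity of the archimedean slot `Φ_∞ ↦ Φ_∞ ⊗ Φ_f` into the `Θ`-initial topology (Weil 1964, Thm 6)

Topic `NumberTheory/Weil1964`; namespace `Literature.NumberTheory.Weil1964`.  KERNEL MATHEMATICS ONLY: no
`def … : Prop` record of a published theorem, no `axiom`, no proof hole; every tag is provenance for a
kernel-checked statement.  Origin: `pub-hodgecm` model construction, producer sub-leaf «W6b-hol-H1» = (W-cont)
under node «W6b-hol» (the hypothesis `hT : IsThetaArchContinuous` of the (ASM) leaf `ThetaHolAssembly`).

SETTING.  `D : WeilThetaDatum Mp S(X)` is a Weil theta datum (`ThetaKernelDualPair.lean`): a group-like `Mp` acting on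
a space of test functions `S(X)` with theta function `Φ ↦ Θ_Φ : Mp → ℂ`; `D.ThetaTop` is `S(X)` with the INITIAL
topology of `Φ ↦ Θ_Φ ∈ (Mp →ᵤ[compacts] ℂ)` (`ThetaInitialTopology.lean`) — the topology in which Weil's Théorème 6
[Weil1964, Chap. III n° 41, p. 193: «Θ_Φ(S) = Σ_{ξ ∈ X_k} (SΦ)(ξ) … dépend continûment de (S, Φ)»] is a tautology
for the `Φ`-variable.  For the datum of a representation `ρ : G →* GL(𝒮(𝔸_F^ι))` (`repWeilThetaDatum`,
`Θ_Φ(g) = Θ(ρ(g)Φ)`), Weil's majorant hypothesis `HasThetaMajorants ρ` [Weil1964, n° 41 Lemme 5 p. 194] gives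
continuity of `g ↦ Θ(ρ(g)Φ)` for each FIXED `Φ` (`HasThetaMajorants.continuous_thetaDistLM`, Théorème 6 conjunct 1).

WHAT IS HERE (all proved).  The question answered: for a LINEAR family of test functions `e ↦ L e ∈ S(X)`
parametrised by a barrelled space `E` (e.g. the Fréchet space `𝓢(X_∞)`, `barrelledSpace_schwartzMap`), when is
`e ↦ L e` continuous INTO `D.ThetaTop`, i.e. when do the theta values `Θ_{L e}(S)` depend continuously on `e`
UNIFORMLY over compact sets of `S`?
* §1 (functional analysis, Banach–Steinhaus [Rudin1991, Thm 2.6]): a family `T_S : E →L[𝕜] 𝕜`, `S ∈ M`, of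
  continuous linear functionals on a BARRELLED space which is pointwise bounded on every compact `K ⊆ M` (in
  particular: `S ↦ T_S e` continuous for every `e`) is equicontinuous on every compact, hence
  `e ↦ (S ↦ T_S e) : E → (M →ᵤ[compacts] 𝕜)` is continuous (`continuous_uniformOnFun_compacts_of_bddOn`,
  `continuous_uniformOnFun_compacts_of_continuous`; Mathlib `WithSeminorms.banach_steinhaus`,
  `equicontinuous_iff_continuous`, `UniformOnFun.continuous_rng_iff`).
* §2 (`WeilThetaDatum.continuous_toThetaTop_of_barrelled`): hence `e ↦ L e` is continuous into `D.ThetaTop` as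
  soon as (i) each slot functional `e ↦ Θ_{L e}(S)` is a continuous linear functional on `E` and (ii) each orbit
  map `S ↦ Θ_{L e}(S)` is continuous — NO strong continuity of the action on `S(X)` is needed.
* §3 (`continuous_toThetaTop_repWeilThetaDatum`): for `D = repWeilThetaDatum F ι ρ Γ` hypothesis (ii) is Weil's
  majorant hypothesis `HasThetaMajorants ρ`, and (i) reads `e ↦ Θ(ρ(g)(L e))` continuous for each `g`.
* §4 (`continuous_toThetaTop_repWeilThetaDatum_tmul`, `…_thinCosetTestFunₗ`): for `E = 𝓢(X_∞)`,
  `L Φ_∞ = Φ_∞ ⊗ Φ_f` (in particular Weil's thin-coset test functions `Φ_∞ ⊗ 1_{x₀ + 𝔫𝒪̂^ι}`,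
  `thinCosetTestFunₗ`), hypothesis (i) follows from LF-CONTINUITY of the operators `ρ(g)` (`IsLFContinuous`,
  [Weil1964, Chap. I n° 11–13: metaplectic operators are automorphisms of the topological vector space 𝒮(X)]):
  `Θ(ρ(g)(Φ_∞ ⊗ Φ_f)) = Σ_j Θ(A_j Φ_∞ ⊗ Ψ_j)` is a finite sum of the continuous theta slices `thetaSliceCLM`
  (`AdelicThetaArchDerivative.lean`) composed with continuous `A_j` (`continuous_thetaDistLM_comp_tmul_of_isLFContinuous`).
  CONCLUSION (W-cont): for an LF-continuous Weil action with theta majorants,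
  `Φ_∞ ↦ Φ_∞ ⊗ 1_{x₀ + 𝔫𝒪̂^ι}` is continuous `𝓢(X_∞) → ThetaTop`, i.e. the theta values satisfy ONE Schwartz
  seminorm bound uniformly over every compact set of the group.

## References

* A. Weil, *Sur certains groupes d'opérateurs unitaires*, Acta Math. 111 (1964) 143–211: Chap. I n° 11 pp. 157–158
  (topology of `𝒮(X)`, continuity of the operators), Chap. III n° 41 Lemme 5 p. 194, Théorème 6 p. 193. [Weil1964]
* W. Rudin, *Functional Analysis*, 2nd ed. (1991), Thm 2.6 (Banach–Steinhaus), Thm 7.4(a). [Rudin1991]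

## Mathlib / tree

Used: `WithSeminorms.banach_steinhaus`, `norm_withSeminorms`, `UniformEquicontinuous.equicontinuous`,
`equicontinuous_iff_continuous`, `UniformOnFun.continuous_rng_iff`, `IsCompact.exists_bound_of_continuousOn`;
from the tree `Literature.Analysis.FunctionSpaces.barrelledSpace_schwartzMap` (`SchwartzComplete`),
`WeilThetaDatum.continuous_rng_iff` / `toThetaTop` (`ThetaInitialTopology`), `repWeilThetaDatum`,
`HasThetaMajorants.continuous_thetaDistLM` (`AdelicThetaMajorants`), `IsLFContinuous` (`AdelicSchwartzBruhatLF`),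
`thetaSliceCLM` (`AdelicThetaArchDerivative`), `thinCosetTestFunₗ_eq_tmul` (`AdelicTensorStripping`).
No definitions.
-/

noncomputable section

open Filter Set Function
open _root_.Topology
open scoped SchwartzMap TensorProduct UniformConvergence NumberField Classical
open NumberField NumberField.mixedEmbedding IsDedekindDomain

namespace Literature.NumberTheory.Weil1964

open Literature.NumberTheory.Automorphic

/-! ## §1. Banach–Steinhaus: pointwise bounded families of functionals and the topology of compact convergence -/

section Barrelled

variable {𝕜 : Type*} [NontriviallyNormedField 𝕜]
variable {E : Type*} [AddCommGroup E] [Module 𝕜 E] [UniformSpace E] [IsUniformAddGroup E]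
  [ContinuousSMul 𝕜 E] [BarrelledSpace 𝕜 E]
variable {M : Type*} [TopologicalSpace M]

omit [TopologicalSpace M] in
/-- **Banach–Steinhaus, equicontinuity form.** A family `T_S`, `S ∈ K`, of continuous linear functionals on a
barrelled space, pointwise bounded on `K`, is equicontinuous (Mathlib `WithSeminorms.banach_steinhaus` for the
norm of `𝕜`). [cite: Rudin1991, Thm 2.6] -/
theorem equicontinuous_restrict_of_bddOn (T : M → E →L[𝕜] 𝕜) (K : Set M)
    (hK : ∀ e : E, ∃ C : ℝ, ∀ S ∈ K, ‖T S e‖ ≤ C) :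
    Equicontinuous fun (S : K) (e : E) => T S e := by
  have H : ∀ (_ : Fin 1) (e : E), BddAbove (range fun S : K => normSeminorm 𝕜 𝕜 (T S e)) := by
    intro _ e
    obtain ⟨C, hC⟩ := hK e
    refine ⟨C, ?_⟩
    rintro _ ⟨S, rfl⟩
    simpa only [coe_normSeminorm] using hC S S.2
  have hequi : UniformEquicontinuous ((↑) ∘ fun S : K => T (S : M)) :=
    (norm_withSeminorms 𝕜 𝕜).banach_steinhaus H
  exact hequi.equicontinuous

/-- **Continuity into `M →ᵤ[compacts] 𝕜` from pointwise bounds on compacts.** If `T_S : E →L[𝕜] 𝕜` (`S ∈ M`,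
`E` barrelled) is pointwise bounded on every compact `K ⊆ M`, then `e ↦ (S ↦ T_S e)` is continuous for the
topology of compact convergence: on each compact the family is equicontinuous (`equicontinuous_restrict_of_bddOn`),
which is exactly continuity of `e ↦ (T_S e)_{S ∈ K}` into `K →ᵤ 𝕜` (`equicontinuous_iff_continuous`), and the
topology of `M →ᵤ[compacts] 𝕜` is initial for these restrictions (`UniformOnFun.continuous_rng_iff`).
[cite: Rudin1991, Thm 2.6] -/
theorem continuous_uniformOnFun_compacts_of_bddOn (T : M → E →L[𝕜] 𝕜)
    (hT : ∀ K : Set M, IsCompact K → ∀ e : E, ∃ C : ℝ, ∀ S ∈ K, ‖T S e‖ ≤ C) :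
    Continuous fun e : E => UniformOnFun.ofFun {K : Set M | IsCompact K} fun S => T S e := by
  rw [UniformOnFun.continuous_rng_iff]
  intro K hK
  have h := equicontinuous_restrict_of_bddOn T K (hT K hK)
  rw [equicontinuous_iff_continuous] at h
  exact h

/-- **Continuity into `M →ᵤ[compacts] 𝕜` from separate continuity.** If each `T_S` is a continuous linear
functional on the barrelled space `E` and each orbit map `S ↦ T_S e` is continuous on `M`, then
`e ↦ (S ↦ T_S e) : E → (M →ᵤ[compacts] 𝕜)` is continuous (pointwise bounds on compacts from
`IsCompact.exists_bound_of_continuousOn`). [cite: Rudin1991, Thm 2.6] -/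
theorem continuous_uniformOnFun_compacts_of_continuous (T : M → E →L[𝕜] 𝕜)
    (hT : ∀ e : E, Continuous fun S => T S e) :
    Continuous fun e : E => UniformOnFun.ofFun {K : Set M | IsCompact K} fun S => T S e :=
  continuous_uniformOnFun_compacts_of_bddOn T fun _ hK e =>
    hK.exists_bound_of_continuousOn (hT e).continuousOn

end Barrelled

/-! ## §2. Weil theta data: continuity into the `Θ`-initial carrier `ThetaTop` -/

section ThetaTop

variable {Mp : Type*} [TopologicalSpace Mp] {SX : Type*}
variable {E : Type*} [AddCommGroup E] [Module ℂ E] [UniformSpace E] [IsUniformAddGroup E]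
  [ContinuousSMul ℂ E] [BarrelledSpace ℂ E]

/-- **Continuity into `ThetaTop` by Banach–Steinhaus.** Let `D` be a Weil theta datum and `e ↦ L e ∈ S(X)` a family
of test functions parametrised by a barrelled space `E` such that (i) every slot functional `e ↦ Θ_{L e}(S)` is a
continuous linear functional `T_S` on `E` and (ii) every orbit map `S ↦ Θ_{L e}(S)` is continuous on `Mp`.  Then
`e ↦ L e` is continuous into `D.ThetaTop` — the theta values depend continuously on `e` uniformly over compact
sets of `Mp` (Weil's Théorème 6 in the `Φ`-variable along the family, with the uniformity coming from barrelledness,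
not from strong continuity of the action). [cite: Weil1964, Chap. III n° 41, Thm 6 p. 193] -/
theorem WeilThetaDatum.continuous_toThetaTop_of_barrelled (D : WeilThetaDatum Mp SX) (L : E → SX)
    (T : Mp → E →L[ℂ] ℂ) (hT : ∀ (S : Mp) (e : E), T S e = D.theta (L e) S)
    (hS : ∀ e : E, Continuous fun S => D.theta (L e) S) :
    Continuous fun e => D.toThetaTop (L e) := by
  rw [WeilThetaDatum.continuous_rng_iff]
  show Continuous fun e => UniformOnFun.ofFun {K : Set Mp | IsCompact K} (D.theta (L e))
  have hfun : (fun e => UniformOnFun.ofFun {K : Set Mp | IsCompact K} fun S => T S e) =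
      fun e => UniformOnFun.ofFun {K : Set Mp | IsCompact K} (D.theta (L e)) := by
    funext e
    congr 1
    funext S
    exact hT S e
  rw [← hfun]
  exact continuous_uniformOnFun_compacts_of_continuous T fun e => by simpa only [hT] using hS e

end ThetaTop

/-! ## §3. The datum of a representation with theta majorants -/

section Rep

variable {F : Type} [Field F] [NumberField F] {ι : Type} [Fintype ι]
variable {G : Type*} [Group G] [TopologicalSpace G]
variable {E : Type*} [AddCommGroup E] [Module ℂ E] [UniformSpace E] [IsUniformAddGroup E]
  [ContinuousSMul ℂ E] [BarrelledSpace ℂ E]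

/-- **(W-cont), abstract form.** For `ρ : G →* GL(𝒮(𝔸_F^ι))` with Weil's theta majorants (Lemme 5, so that
`g ↦ Θ(ρ(g)Φ)` is continuous for each `Φ`, Théorème 6 conjunct 1) and a LINEAR family `L : E →ₗ 𝒮(𝔸_F^ι)` from a
barrelled space whose slot functionals `e ↦ Θ(ρ(g)(L e))` are continuous for every `g`, the family is continuous
into the `Θ`-initial carrier: `e ↦ L e : E → (repWeilThetaDatum F ι ρ Γ).ThetaTop` is continuous.
[cite: Weil1964, Chap. III n° 41, Lemme 5 p. 194, Thm 6 p. 193] -/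
theorem continuous_toThetaTop_repWeilThetaDatum (ρ : G →* (Module.End ℂ (piSchwartzBruhat F ι))ˣ) (Γ : Set G)
    (hρ : HasThetaMajorants fun (g : G) (Φ : piSchwartzBruhat F ι) =>
      (ρ g : Module.End ℂ (piSchwartzBruhat F ι)) Φ)
    (L : E →ₗ[ℂ] piSchwartzBruhat F ι)
    (hL : ∀ g : G, Continuous fun e => thetaDistLM F ι ((ρ g : Module.End ℂ (piSchwartzBruhat F ι)) (L e))) :
    Continuous fun e => (repWeilThetaDatum F ι ρ Γ).toThetaTop (L e) :=
  (repWeilThetaDatum F ι ρ Γ).continuous_toThetaTop_of_barrelled L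
    (fun g => ⟨thetaDistLM F ι ∘ₗ (ρ g : Module.End ℂ (piSchwartzBruhat F ι)) ∘ₗ L, hL g⟩)
    (fun _ _ => rfl) fun e => hρ.continuous_thetaDistLM (L e)

end Rep

/-! ## §4. The archimedean slot `Φ_∞ ↦ Φ_∞ ⊗ Φ_f` of an LF-continuous action -/

section Arch

variable {F : Type} [Field F] [NumberField F] {n : ℕ}
variable {G : Type*} [Group G] [TopologicalSpace G]

/-- **Slot continuity from LF-continuity.** For an LF-continuous operator `M` of `𝒮(𝔸_F^n)` and a finite test function
`Φ_f`, `Φ_∞ ↦ Θ(M(Φ_∞ ⊗ Φ_f))` is continuous on `𝓢(X_∞)`: on the piece of `Φ_f`,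
`M(Φ_∞ ⊗ Φ_f) = Σ_j A_j Φ_∞ ⊗ Ψ_j` with continuous `A_j`, and each theta slice `Φ ↦ Θ(Φ ⊗ Ψ_j)` is a continuous linear
functional (`thetaSliceCLM`). [cite: Weil1964, Chap. I n° 11 pp. 157–158; Chap. III n° 41 p. 193] -/
theorem continuous_thetaDistLM_comp_tmul_of_isLFContinuous
    {M : piSchwartzBruhat F (Fin n) →ₗ[ℂ] piSchwartzBruhat F (Fin n)} (hM : IsLFContinuous M)
    (Φf : FinSB F (Fin n)) :
    Continuous fun φ : 𝓢((Fin n → mixedSpace F), ℂ) =>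
      thetaDistLM F (Fin n) (M (piSchwartzBruhatEquiv F (Fin n) (φ ⊗ₜ Φf))) := by
  obtain ⟨κ, _, A, Ψ, hA⟩ := hM Φf
  have h : (fun φ : 𝓢((Fin n → mixedSpace F), ℂ) =>
        thetaDistLM F (Fin n) (M (piSchwartzBruhatEquiv F (Fin n) (φ ⊗ₜ Φf)))) =
      fun φ => ∑ j, thetaSliceCLM F n (Ψ j) (A j φ) := by
    funext φ
    rw [hA, map_sum]
    simp only [thetaSliceCLM_apply]
  rw [h]
  exact continuous_finsetSum _ fun j _ => (thetaSliceCLM F n (Ψ j)).continuous.comp (A j).continuous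

/-- **(W-cont) for pure tensors.** For an LF-continuous Weil action `ρ` of `G` on `𝒮(𝔸_F^n)` with theta majorants and a
finite test function `Φ_f`, the archimedean slot `Φ_∞ ↦ Φ_∞ ⊗ Φ_f` is continuous from the Schwartz space `𝓢(X_∞)`
(Fréchet, hence barrelled: `barrelledSpace_schwartzMap`) into the `Θ`-initial carrier of `repWeilThetaDatum F (Fin n) ρ Γ`:
the theta values `Θ(ρ(g)(Φ_∞ ⊗ Φ_f))` obey one Schwartz-seminorm bound uniformly over every compact set of `g`.
[cite: Weil1964, Chap. III n° 41, Thm 6 p. 193] -/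
theorem continuous_toThetaTop_repWeilThetaDatum_tmul
    (ρ : G →* (Module.End ℂ (piSchwartzBruhat F (Fin n)))ˣ) (Γ : Set G)
    (hρ : HasThetaMajorants fun (g : G) (Φ : piSchwartzBruhat F (Fin n)) =>
      (ρ g : Module.End ℂ (piSchwartzBruhat F (Fin n))) Φ)
    (hLF : ∀ g : G, IsLFContinuous (ρ g : Module.End ℂ (piSchwartzBruhat F (Fin n))))
    (Φf : FinSB F (Fin n)) :
    Continuous fun φ : 𝓢((Fin n → mixedSpace F), ℂ) =>
      (repWeilThetaDatum F (Fin n) ρ Γ).toThetaTop (piSchwartzBruhatEquiv F (Fin n) (φ ⊗ₜ Φf)) := by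
  haveI : BarrelledSpace ℂ 𝓢((Fin n → mixedSpace F), ℂ) :=
    Literature.Analysis.FunctionSpaces.barrelledSpace_schwartzMap
  exact continuous_toThetaTop_repWeilThetaDatum ρ Γ hρ
    ((piSchwartzBruhatEquiv F (Fin n)).toLinearMap ∘ₗ
      (TensorProduct.mk ℂ 𝓢((Fin n → mixedSpace F), ℂ) (FinSB F (Fin n))).flip Φf)
    fun g => continuous_thetaDistLM_comp_tmul_of_isLFContinuous (hLF g) Φf

/-- **(W-cont) for the thin-coset test functions** `Φ_∞ ↦ Φ_∞ ⊗ 1_{x₀ + 𝔫𝒪̂^n}` (`thinCosetTestFunₗ x₀ 𝔫`, the pure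
tensor `Φ_∞ ⊗ 1_{𝔫𝒪̂^n}(−x₀ + ·)`, `thinCosetTestFunₗ_eq_tmul`): continuous from `𝓢(X_∞)` into the `Θ`-initial carrier
of an LF-continuous Weil action with theta majorants. [cite: Weil1964, Chap. III n° 41, Thm 6 p. 193] -/
theorem continuous_toThetaTop_repWeilThetaDatum_thinCosetTestFunₗ
    (ρ : G →* (Module.End ℂ (piSchwartzBruhat F (Fin n)))ˣ) (Γ : Set G)
    (hρ : HasThetaMajorants fun (g : G) (Φ : piSchwartzBruhat F (Fin n)) =>
      (ρ g : Module.End ℂ (piSchwartzBruhat F (Fin n))) Φ)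
    (hLF : ∀ g : G, IsLFContinuous (ρ g : Module.End ℂ (piSchwartzBruhat F (Fin n))))
    (x₀ : Fin n → FiniteAdeleRing (𝓞 F) F) (𝔫 : Ideal (𝓞 F)) :
    Continuous fun φ : 𝓢((Fin n → mixedSpace F), ℂ) =>
      (repWeilThetaDatum F (Fin n) ρ Γ).toThetaTop (thinCosetTestFunₗ (K := F) (ι := Fin n) x₀ 𝔫 φ) := by
  simp_rw [thinCosetTestFunₗ_eq_tmul]
  exact continuous_toThetaTop_repWeilThetaDatum_tmul ρ Γ hρ hLF _

end Arch

end Literature.NumberTheory.Weil1964
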